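import Summits.RiemannHypothesis.RiemannHypothesis.Theorems.GroundBartaPolarPerronFrobeniusCruxBridge
import Summits.RiemannHypothesis.RiemannHypothesis.Theorems.GroundBartaPolarPerronFrobeniusEvenSectorEulerLagrange
import Literature.NumberTheory.LFunctions.WeilMarkovQuadratic
import Literature.NumberTheory.LFunctions.WeilMellinInversion
import Literature.NumberTheory.LFunctions.WeilExplicitProofs
import Literature.NumberTheory.LFunctions.WeilGroundStateRealZerosProofs
import Literature.NumberTheory.LFunctions.WeilMellinBounds
import Literature.NumberTheory.LFunctions.WeilGroundEnergyProofs
import Literature.NumberTheory.LFunctions.WeilWindowSimpleEven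
import HarnessLib

/-!
# Route `EvenSectorBarta`, crux `EvenOneSignedWindows` (stmt-RiemannHypothesis-19953):
# the ANTI-MAXIMUM-PRINCIPLE reduction (typed mechanism interface, RH-free helper)

Publication cell `pub-rhpf` (Perron–Frobenius persistence seat).  Framing: long-odds MECHANISM
SEARCH — nothing here is a claim about RH; every RH-bearing statement below is an explicit
HYPOTHESIS of a theorem, never a fact.  In the even sector of the window `[-a, a]` Weil's form is
`Re Q = Q₀ + P` with `P(g) = 2|∫ g cosh(t/2)|²` (rank-one pole form) and `Q₀` the pole-free form
(`weilMarkovQuadratic`, Bombieri 2000 Thm 2).  Factorising the polar term in the weak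
Euler–Lagrange equation of an even-sector bottom state `u` (tree theorem
`IsWeilEvenGroundState.exists_eulerLagrange_even`) gives, when `p = ∫ u cosh(t/2) ≠ 0`, the POLAR
RESOLVENT REPRESENTATION `u = -2p · w`, `w` a weak solution of `(Q₀ − ε_ev(a)) w = cosh(t/2)`.
Since `ε_ev(a)` lies above the bottom of `Q₀`, the sign of `w` is governed by the ANTI-MAXIMUM
PRINCIPLE (Clément–Peletier 1979; Daners–Glück–Kennedy 2016 Thm 1.1; Arora–Glück 2021), stated here
as the window hypothesis `AntiMaximumWindow[Seq] a`.  Main theorems: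
`polarRepresentableSeq_of_integral_cosh_ne_zero` (representability is a THEOREM in the sequential
formulation) and `evenOneSignedWindows_of_antiMaximumSeq` — cofinally (sequential AMP window ∧ a
bottom state with `∫ u cosh(t/2) ≠ 0`) ⇒ `EvenSectorBarta.EvenOneSignedWindows`.  Numerical side
(AMP margin vs `ε_ev(a)`, atlas `pub-weilobs`): `run/shared/lean/pub/pub-rhpf/PF.md` §5.
References: E. Bombieri, Rend. Lincei (9) 11 (2000) Thm 2, §4; Ph. Clément, L. A. Peletier,
J. Differential Equations 34 (1979) 218–229; D. Daners, J. Glück, J. B. Kennedy, J. Math. Anal.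
Appl. 433 (2016), arXiv:1511.09020, Thm 1.1; S. Arora, J. Glück, arXiv:2104.12205.
-/

set_option linter.dupNamespace false

noncomputable section

open MeasureTheory Set Filter Complex
open scoped Real Topology ComplexConjugate

namespace Summit.RiemannHypothesis.RiemannHypothesis.Theorems.PolarPerronFrobenius

open Literature.NumberTheory.LFunctions

/-! ## Definitions: the pole-free functional, weak resolvent solutions, the AMP window -/

/-- The **pole-free Weil functional** `W₀(k) = W(k) − (k̂(0) + k̂(1)) = −(prime term) + (archimedean
term)` (Bombieri 2000 Thm 2 with the polar term removed). [cite: Bombieri2000Weil, Thm 2 (p. 193)] -/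
def weilPoleFreeFunctional (k : ℝ → ℂ) : ℂ :=
  weilFunctional k - weilPolarTerm k

/-- **Weak pole-free resolvent solution** at level `E` for the polar datum `cosh(t/2)` on the even
sector of the window `[-a, a]`: `w ∈ L²` and `W₀(w ⋆ h̃) − E ∫ w h̄ = ∫ cosh(t/2) h̄(t) dt` for every
EVEN window test `h` (the sesquilinear pole-free form paired against tests, so that only `w ∈ L²`
is needed). [folklore] -/
def IsPoleFreeResolventSol (a E : ℝ) (w : ℝ → ℂ) : Prop :=
  MemLp w 2 volume ∧
    ∀ h : ℝ → ℂ, IsWeilTest h → tsupport h ⊆ Icc (-a) a → (∀ t, h (-t) = h t) →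
      weilPoleFreeFunctional (weilConv w (weilReflect h)) - (E : ℂ) * ∫ t, w t * conj (h t) =
        ∫ t, (Real.cosh (t / 2) : ℂ) * conj (h t)

/-- **The anti-maximum window condition at `a`** (the RH-bearing mechanism hypothesis): every weak
pole-free resolvent solution at the even bottom level `ε_ev(a) = weilEvenGroundEnergy a` is real
and `≤ 0` a.e. on `(-a, a)` (anti-maximum principle for the positive datum `cosh(t/2)` at a level
above the principal eigenvalue of the pole-free form; Clément–Peletier 1979, Daners–Glück–Kennedy
2016 Thm 1.1 (ii)).  A DEFINITION used only as an explicit hypothesis — posited, not a fact. -/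
def AntiMaximumWindow (a : ℝ) : Prop :=
  ∀ w : ℝ → ℂ, IsPoleFreeResolventSol a (weilEvenGroundEnergy a) w →
    ∀ᵐ t : ℝ, t ∈ Ioo (-a) a → (w t).im = 0 ∧ (w t).re ≤ 0

/-- **Polar resolvent representability** of `u` at window `a`: `u = κ · w` pointwise for a constant
`κ ≠ 0` and a weak pole-free resolvent solution `w` at the even bottom level. [folklore] -/
def PolarRepresentable (a : ℝ) (u : ℝ → ℂ) : Prop :=
  ∃ κ : ℂ, κ ≠ 0 ∧ ∃ w : ℝ → ℂ, IsPoleFreeResolventSol a (weilEvenGroundEnergy a) w ∧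
    ∀ t, u t = κ * w t

/-! ## Linearity of the pole-free functional -/

/-- `W₀(m k) = m W₀(k)` (no hypotheses; `weilFunctional_const_mul`, `weilMellin_const_mul`).
[folklore] -/
theorem weilPoleFreeFunctional_const_mul (m : ℂ) (k : ℝ → ℂ) :
    weilPoleFreeFunctional (fun t ↦ m * k t) = m * weilPoleFreeFunctional k := by
  have hP : weilPolarTerm (fun t ↦ m * k t) = m * weilPolarTerm k := by
    simp only [weilPolarTerm, weilMellin_const_mul]
    ring
  simp only [weilPoleFreeFunctional, weilFunctional_const_mul, hP]
  ring

/-! ## Phase invariance of even-sector bottom states -/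

/-- A unimodular multiple `ζ u` (`‖ζ‖ = 1`) of an even-sector bottom state is an even-sector bottom
state (run the minimising sequence `ζ gₙ`: `Q(ζ g) = |ζ|² Q(g)`). [folklore] -/
theorem _root_.Literature.NumberTheory.LFunctions.IsWeilEvenGroundState.const_mul_unit
    {a : ℝ} {u : ℝ → ℂ} (hu : IsWeilEvenGroundState a u) {ζ : ℂ} (hζ : ‖ζ‖ = 1) :
    IsWeilEvenGroundState a (fun t ↦ ζ * u t) := by
  obtain ⟨hu2, g, hg, hmin, hL⟩ := hu
  refine ⟨hu2.const_mul ζ, fun n t ↦ ζ * g n t, fun n ↦ ⟨(hg n).1.const_mul ζ, ?_, ?_, ?_⟩, ?_, ?_⟩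
  · exact (tsupport_mul_subset_right (f := fun _ : ℝ ↦ ζ) (g := g n)).trans (hg n).2.1
  · intro t
    show ζ * g n (-t) = ζ * g n t
    rw [(hg n).2.2.1 t]
  · have : (fun t ↦ ‖ζ * g n t‖ ^ 2) = fun t ↦ ‖g n t‖ ^ 2 := by
      funext t
      simp [hζ]
    rw [this]
    exact (hg n).2.2.2
  · intro h hh hhs hhe hh1 δ hδ
    have hQ : ∀ n, (weilQuadratic (fun t ↦ ζ * g n t)).re = (weilQuadratic (g n)).re := by
      intro n
      have hn : (Complex.normSq ζ : ℂ) = 1 := by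
        rw [Complex.normSq_eq_norm_sq, hζ]
        simp
      rw [weilQuadratic_const_mul, hn, one_mul]
    simp only [hQ]
    exact hmin h hh hhs hhe hh1 δ hδ
  · have : (fun n ↦ ∫ t, ‖ζ * g n t - ζ * u t‖ ^ 2) = fun n ↦ ∫ t, ‖g n t - u t‖ ^ 2 := by
      funext n
      congr 1 with t
      rw [← mul_sub, norm_mul, hζ, one_mul]
    rw [this]
    exact hL

/-! ## The reduction of the crux to the anti-maximum window condition -/

/-- **Anti-maximum reduction of `EvenOneSignedWindows`.**  If beyond every height there is a window
`a` at which (i) the anti-maximum window condition holds and (ii) some even-sector bottom state is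
polar-representable, then item `EvenOneSignedWindows` (stmt-RiemannHypothesis-19953) holds: the
state is `κ w` with `w ≤ 0` real a.e. on the window, and its unimodular multiple
`(−conj κ/‖κ‖)·u = −‖κ‖ w` is an even-sector bottom state that is real and `≥ 0` a.e. on `(-a, a)`.
[folklore] -/
theorem evenOneSignedWindows_of_antiMaximum
    (h : ∀ A : ℝ, ∃ a : ℝ, A ≤ a ∧ AntiMaximumWindow a ∧
      ∃ u : ℝ → ℂ, IsWeilEvenGroundState a u ∧ PolarRepresentable a u) :
    Summit.RiemannHypothesis.RiemannHypothesis.Theses.EvenSectorBarta.EvenOneSignedWindows := by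
  refine evenOneSignedWindows_iff_cofinal.2 fun A ↦ ?_
  obtain ⟨a, hAa, hAMP, u, hu, κ, hκ, w, hw, huw⟩ := h A
  have hnorm : (‖κ‖ : ℂ) ≠ 0 := by exact_mod_cast norm_ne_zero_iff.2 hκ
  set ζ : ℂ := -(conj κ) / (‖κ‖ : ℂ) with hζ_def
  have hζ : ‖ζ‖ = 1 := by
    rw [hζ_def, norm_div, norm_neg, Complex.norm_conj, Complex.norm_real, Real.norm_eq_abs,
      abs_norm, div_self (norm_ne_zero_iff.2 hκ)]
  have hζu : ∀ t, ζ * u t = -(‖κ‖ : ℂ) * w t := by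
    intro t
    calc ζ * u t = -(conj κ * κ) / (‖κ‖ : ℂ) * w t := by rw [huw t, hζ_def]; ring
      _ = -((‖κ‖ : ℂ) ^ 2) / (‖κ‖ : ℂ) * w t := by rw [Complex.conj_mul']
      _ = -(‖κ‖ : ℂ) * w t := by
          rw [div_mul_eq_mul_div, div_eq_iff hnorm]
          ring
  refine ⟨a, hAa, fun t ↦ ζ * u t, hu.const_mul_unit hζ, ?_⟩
  filter_upwards [hAMP w hw] with t ht hta
  obtain ⟨him, hre⟩ := ht hta
  rw [hζu t]
  refine ⟨?_, ?_⟩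
  · rw [show -(‖κ‖ : ℂ) = ((-‖κ‖ : ℝ) : ℂ) by push_cast; ring, Complex.im_ofReal_mul, him, mul_zero]
  · rw [show -(‖κ‖ : ℂ) = ((-‖κ‖ : ℝ) : ℂ) by push_cast; ring, Complex.re_ofReal_mul]
    exact mul_nonneg_of_nonpos_of_nonpos (neg_nonpos.2 (norm_nonneg κ)) hre

/-! ## Sequential (limit) form: polar representability from the tree's Euler–Lagrange theorem -/

/-- **Sequential weak pole-free resolvent solution** at level `E` for the datum `cosh(t/2)` on the
even sector of `[-a, a]`: `w ∈ L²` is the `L²`-limit of EVEN window test functions `vₙ` with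
`W₀(vₙ ⋆ h̃) − E ∫ vₙ h̄ → ∫ cosh(t/2) h̄(t) dt` for every EVEN window test `h`. [folklore] -/
def IsPoleFreeResolventSolSeq (a E : ℝ) (w : ℝ → ℂ) : Prop :=
  MemLp w 2 volume ∧ ∃ v : ℕ → ℝ → ℂ,
    (∀ n, IsWeilTest (v n) ∧ tsupport (v n) ⊆ Icc (-a) a ∧ (∀ t, v n (-t) = v n t)) ∧
    Tendsto (fun n ↦ ∫ t, ‖v n t - w t‖ ^ 2) atTop (𝓝 0) ∧
    ∀ h : ℝ → ℂ, IsWeilTest h → tsupport h ⊆ Icc (-a) a → (∀ t, h (-t) = h t) →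
      Tendsto (fun n ↦ weilPoleFreeFunctional (weilConv (v n) (weilReflect h)) -
          (E : ℂ) * ∫ t, v n t * conj (h t)) atTop
        (𝓝 (∫ t, (Real.cosh (t / 2) : ℂ) * conj (h t)))

/-- **Sequential anti-maximum window condition at `a`**: every sequential weak pole-free resolvent
solution at the even bottom level `ε_ev(a)` is real and `≤ 0` a.e. on `(-a, a)`.  A DEFINITION used
only as an explicit hypothesis — posited, not a fact. -/
def AntiMaximumWindowSeq (a : ℝ) : Prop :=
  ∀ w : ℝ → ℂ, IsPoleFreeResolventSolSeq a (weilEvenGroundEnergy a) w →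
    ∀ᵐ t : ℝ, t ∈ Ioo (-a) a → (w t).im = 0 ∧ (w t).re ≤ 0

/-- **Sequential polar representability**: `u = κ w`, `κ ≠ 0`, `w` a sequential weak pole-free
resolvent solution at the even bottom level. [folklore] -/
def PolarRepresentableSeq (a : ℝ) (u : ℝ → ℂ) : Prop :=
  ∃ κ : ℂ, κ ≠ 0 ∧ ∃ w : ℝ → ℂ, IsPoleFreeResolventSolSeq a (weilEvenGroundEnergy a) w ∧
    ∀ t, u t = κ * w t

/-- For an even function the transform takes the same value at the two poles: `ĝ(1) = ĝ(0)`
(`weilMellin_comp_neg`). [folklore] -/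
theorem weilMellin_one_eq_zero_of_even {g : ℝ → ℂ} (hev : ∀ t, g (-t) = g t) :
    weilMellin g 1 = weilMellin g 0 := by
  have h := weilMellin_comp_neg g 1
  have hfun : (fun t ↦ g (-t)) = g := funext hev
  rw [hfun, sub_self] at h
  exact h

/-- For an even test function `ĝ(1) = ∫ g(x) cosh(x/2) dx` (the `sinh` moment vanishes).
[folklore] -/
theorem weilMellin_one_eq_integral_cosh_of_even {g : ℝ → ℂ} (hg : IsWeilTest g)
    (hev : ∀ t, g (-t) = g t) :
    weilMellin g 1 = ∫ x : ℝ, g x * (Real.cosh (x / 2) : ℂ) := by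
  have h1 := weilMellin_one_eq_cosh_add_sinh hg
  have h0 := weilMellin_zero_eq_cosh_sub_sinh hg
  have h10 := weilMellin_one_eq_zero_of_even hev
  linear_combination (h1 + h0 + h10) / 2

/-- For an even test function `ĝ(0) = ∫ g(x) cosh(x/2) dx`. [folklore] -/
theorem weilMellin_zero_eq_integral_cosh_of_even {g : ℝ → ℂ} (hg : IsWeilTest g)
    (hev : ∀ t, g (-t) = g t) :
    weilMellin g 0 = ∫ x : ℝ, g x * (Real.cosh (x / 2) : ℂ) := by
  rw [← weilMellin_one_eq_zero_of_even hev, weilMellin_one_eq_integral_cosh_of_even hg hev]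

/-- **Rank-one factorisation of the polar term in the even sector**: for EVEN test functions
`g, h`, `(g ⋆ h̃)^(0) + (g ⋆ h̃)^(1) = 2 (∫ g cosh(t/2)) (∫ cosh(t/2) h̄)`
(`(g ⋆ h̃)^(s) = ĝ(s) conj ĥ(1 - conj s)`, Bombieri 2000 §3). [cite: Bombieri2000Weil, §3] -/
theorem weilPolarTerm_weilConv_weilReflect_of_even {g h : ℝ → ℂ} (hg : IsWeilTest g)
    (hh : IsWeilTest h) (hge : ∀ t, g (-t) = g t) (hhe : ∀ t, h (-t) = h t) :
    weilPolarTerm (weilConv g (weilReflect h)) =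
      2 * (∫ t, g t * (Real.cosh (t / 2) : ℂ)) * ∫ t, (Real.cosh (t / 2) : ℂ) * conj (h t) := by
  have hmul : ∀ s, weilMellin (weilConv g (weilReflect h)) s =
      weilMellin g s * weilMellin (weilReflect h) s :=
    fun s ↦ weilMellin_weilConv_holds hg.1.continuous hg.2 hh.weilReflect.1.continuous
      hh.weilReflect.2 s
  have hconj : conj (∫ t, h t * (Real.cosh (t / 2) : ℂ)) =
      ∫ t, (Real.cosh (t / 2) : ℂ) * conj (h t) := by
    rw [← integral_conj]
    congr 1 with t
    rw [map_mul, Complex.conj_ofReal, mul_comm]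
  unfold weilPolarTerm
  rw [hmul, hmul, weilMellin_weilReflect_holds, weilMellin_weilReflect_holds]
  simp only [map_zero, map_one, sub_zero, sub_self]
  rw [weilMellin_zero_eq_integral_cosh_of_even hg hge, weilMellin_one_eq_integral_cosh_of_even hg hge,
    weilMellin_zero_eq_integral_cosh_of_even hh hhe, weilMellin_one_eq_integral_cosh_of_even hh hhe,
    hconj]
  ring

/-- The truncated polar vector `𝟙_{[-a,a]} cosh(t/2)` is in `L²`. [folklore] -/
theorem memLp_indicator_cosh (a : ℝ) :
    MemLp ((Icc (-a) a).indicator fun t : ℝ ↦ (Real.cosh (t / 2) : ℂ)) 2 volume := by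
  rw [memLp_indicator_iff_restrict measurableSet_Icc]
  have hc : Continuous fun t : ℝ ↦ (Real.cosh (t / 2) : ℂ) :=
    Complex.continuous_ofReal.comp (Real.continuous_cosh.comp (continuous_id.div_const 2))
  refine MemLp.of_bound hc.aestronglyMeasurable (Real.cosh (a / 2)) ?_
  refine ae_restrict_of_forall_mem measurableSet_Icc fun t ht ↦ ?_
  rw [Complex.norm_real, Real.norm_eq_abs, abs_of_nonneg (Real.cosh_pos _).le, Real.cosh_le_cosh]
  have h1 : |t| ≤ a := abs_le.2 ⟨ht.1, ht.2⟩
  have ha : 0 ≤ a := (abs_nonneg t).trans h1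
  rw [abs_div, abs_div, abs_of_nonneg ha, abs_two]
  exact div_le_div_of_nonneg_right h1 zero_le_two

/-- Along the even minimising sequence the polar moments converge:
`∫ gₙ cosh(t/2) → ∫ u cosh(t/2)` (pair against the truncated polar vector in `L²`). [folklore] -/
theorem tendsto_integral_mul_cosh {a : ℝ} {u : ℝ → ℂ} (hu : IsWeilEvenGroundState a u)
    {g : ℕ → ℝ → ℂ}
    (hg : ∀ n, IsWeilTest (g n) ∧ tsupport (g n) ⊆ Icc (-a) a ∧ (∀ t, g n (-t) = g n t) ∧
      ∫ t, ‖g n t‖ ^ 2 = (1 : ℝ))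
    (hL : Tendsto (fun n ↦ ∫ t, ‖g n t - u t‖ ^ 2) atTop (𝓝 0)) :
    Tendsto (fun n ↦ ∫ t, g n t * (Real.cosh (t / 2) : ℂ)) atTop
      (𝓝 (∫ t, u t * (Real.cosh (t / 2) : ℂ))) := by
  set χ : ℝ → ℂ := (Icc (-a) a).indicator fun t : ℝ ↦ (Real.cosh (t / 2) : ℂ) with hχ
  have hconjχ : ∀ t, conj (χ t) = χ t := by
    intro t
    by_cases ht : t ∈ Icc (-a) a
    · simp only [hχ, Set.indicator_of_mem ht, Complex.conj_ofReal]
    · simp only [hχ, Set.indicator_of_notMem ht, map_zero]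
  have key : Tendsto (fun n ↦ ∫ t, g n t * conj (χ t)) atTop (𝓝 (∫ t, u t * conj (χ t))) :=
    ConnesVanSuijlekom.tendsto_integral_mul_conj_left (memLp_indicator_cosh a) hu.memLp
      (fun n ↦ ConnesVanSuijlekom.isWeilTest_memLp (hg n).1) hL
  have hgn : ∀ n, (∫ t, g n t * conj (χ t)) = ∫ t, g n t * (Real.cosh (t / 2) : ℂ) := by
    intro n
    congr 1 with t
    rw [hconjχ t]
    by_cases ht : t ∈ Icc (-a) a
    · simp [hχ, ht]
    · have : g n t = 0 := image_eq_zero_of_notMem_tsupport fun h' ↦ ht ((hg n).2.1 h')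
      simp [this]
  have hul : (∫ t, u t * conj (χ t)) = ∫ t, u t * (Real.cosh (t / 2) : ℂ) := by
    refine integral_congr_ae ?_
    filter_upwards [hu.ae_eq_zero_of_notMem] with t ht
    rw [hconjχ t]
    by_cases hm : t ∈ Icc (-a) a
    · simp [hχ, hm]
    · simp [ht hm]
  rw [hul] at key
  exact key.congr hgn

/-- **Polar representability is automatic.**  If `u` is an even-sector bottom state at `a` with
`p = ∫ u cosh(t/2) ≠ 0`, then `u = (−2p) w` with `w` a sequential weak pole-free resolvent solution
at level `ε_ev(a)`: run the even minimising sequence `gₙ → u` of the weak Euler–Lagrange theorem,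
factorise the polar term of `W(gₙ ⋆ h̃)` (rank one in the even sector) and pass to the limit.
[cite: Bombieri2000Weil, §4 Lemma 1, (4.2)] -/
theorem polarRepresentableSeq_of_integral_cosh_ne_zero {a : ℝ} {u : ℝ → ℂ}
    (hu : IsWeilEvenGroundState a u) (hp : (∫ t, u t * (Real.cosh (t / 2) : ℂ)) ≠ 0) :
    PolarRepresentableSeq a u := by
  obtain ⟨g, hg, hQ, hL, hEL⟩ := hu.exists_eulerLagrange_even
  set p : ℂ := ∫ t, u t * (Real.cosh (t / 2) : ℂ) with hp_def
  set E : ℝ := weilEvenGroundEnergy a with hE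
  have h2p : (2 * p) ≠ 0 := mul_ne_zero two_ne_zero hp
  set c : ℂ := -(2 * p)⁻¹ with hc
  refine ⟨-(2 * p), neg_ne_zero.2 h2p, fun t ↦ c * u t, ⟨hu.memLp.const_mul c, fun n t ↦ c * g n t,
    fun n ↦ ⟨(hg n).1.const_mul c, ?_, fun t ↦ by simp only [(hg n).2.2.1 t]⟩, ?_, ?_⟩, ?_⟩
  · exact (tsupport_mul_subset_right (f := fun _ : ℝ ↦ c) (g := g n)).trans (hg n).2.1
  · have : (fun n ↦ ∫ t, ‖c * g n t - c * u t‖ ^ 2) = fun n ↦ ‖c‖ ^ 2 * ∫ t, ‖g n t - u t‖ ^ 2 := by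
      funext n
      rw [← integral_const_mul]
      congr 1 with t
      rw [← mul_sub, norm_mul, mul_pow]
    rw [this]
    simpa using hL.const_mul (‖c‖ ^ 2)
  · intro h hh hhs hhe
    set D : ℂ := ∫ t, (Real.cosh (t / 2) : ℂ) * conj (h t) with hD
    -- the three convergent sequences
    have T1 := hEL h hh hhs hhe
    have T2 := ConnesVanSuijlekom.tendsto_integral_mul_conj_left (ConnesVanSuijlekom.isWeilTest_memLp hh)
      hu.memLp (fun n ↦ ConnesVanSuijlekom.isWeilTest_memLp (hg n).1) hL
    have T3 := tendsto_integral_mul_cosh hu hg hL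
    -- rewrite the resolvent expression through them
    have key : ∀ n, weilPoleFreeFunctional (weilConv (fun t ↦ c * g n t) (weilReflect h)) -
        (E : ℂ) * ∫ t, c * g n t * conj (h t) =
        c * (weilFunctional (weilConv (g n) (weilReflect h)) -
          2 * (∫ t, g n t * (Real.cosh (t / 2) : ℂ)) * D) - (E : ℂ) * (c * ∫ t, g n t * conj (h t)) := by
      intro n
      have hint : (∫ t, c * g n t * conj (h t)) = c * ∫ t, g n t * conj (h t) := by
        rw [← integral_const_mul]
        congr 1 with t
        ring
      rw [weilConv_const_mul_left, weilPoleFreeFunctional_const_mul, hint, weilPoleFreeFunctional,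
        weilPolarTerm_weilConv_weilReflect_of_even (hg n).1 hh (hg n).2.2.1 hhe]
    have hlim : Tendsto (fun n ↦ c * (weilFunctional (weilConv (g n) (weilReflect h)) -
          2 * (∫ t, g n t * (Real.cosh (t / 2) : ℂ)) * D) - (E : ℂ) * (c * ∫ t, g n t * conj (h t)))
        atTop (𝓝 (c * ((E : ℂ) * (∫ t, u t * conj (h t)) - 2 * p * D) -
          (E : ℂ) * (c * ∫ t, u t * conj (h t)))) :=
      ((T1.sub ((T3.const_mul 2).mul_const D)).const_mul c).sub ((T2.const_mul c).const_mul (E : ℂ))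
    have hval : c * ((E : ℂ) * (∫ t, u t * conj (h t)) - 2 * p * D) -
        (E : ℂ) * (c * ∫ t, u t * conj (h t)) = D := by
      have hpinv : (2 * p)⁻¹ * (2 * p) = 1 := inv_mul_cancel₀ h2p
      rw [hc]
      linear_combination D * hpinv
    rw [hval] at hlim
    exact hlim.congr fun n ↦ (key n).symm
  · intro t
    have hpinv : (2 * p) * (2 * p)⁻¹ = 1 := mul_inv_cancel₀ h2p
    rw [hc]
    linear_combination (-(u t)) * hpinv

/-- **Anti-maximum reduction of `EvenOneSignedWindows`, sequential form.**  If beyond every height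
there is a window `a` at which the sequential anti-maximum window condition holds and some
even-sector bottom state is not orthogonal to the polar vector `cosh(t/2)`, then
`EvenOneSignedWindows` (stmt-RiemannHypothesis-19953) holds.  All analytic content is in
`AntiMaximumWindowSeq`; the representation step is the theorem above. [folklore] -/
theorem evenOneSignedWindows_of_antiMaximumSeq
    (h : ∀ A : ℝ, ∃ a : ℝ, A ≤ a ∧ AntiMaximumWindowSeq a ∧
      ∃ u : ℝ → ℂ, IsWeilEvenGroundState a u ∧ (∫ t, u t * (Real.cosh (t / 2) : ℂ)) ≠ 0) :
    Summit.RiemannHypothesis.RiemannHypothesis.Theses.EvenSectorBarta.EvenOneSignedWindows := by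
  refine evenOneSignedWindows_iff_cofinal.2 fun A ↦ ?_
  obtain ⟨a, hAa, hAMP, u, hu, hp⟩ := h A
  obtain ⟨κ, hκ, w, hw, huw⟩ := polarRepresentableSeq_of_integral_cosh_ne_zero hu hp
  have hnorm : (‖κ‖ : ℂ) ≠ 0 := by exact_mod_cast norm_ne_zero_iff.2 hκ
  set ζ : ℂ := -(conj κ) / (‖κ‖ : ℂ) with hζ_def
  have hζ : ‖ζ‖ = 1 := by
    rw [hζ_def, norm_div, norm_neg, Complex.norm_conj, Complex.norm_real, Real.norm_eq_abs,
      abs_norm, div_self (norm_ne_zero_iff.2 hκ)]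
  have hζu : ∀ t, ζ * u t = -(‖κ‖ : ℂ) * w t := by
    intro t
    calc ζ * u t = -(conj κ * κ) / (‖κ‖ : ℂ) * w t := by rw [huw t, hζ_def]; ring
      _ = -((‖κ‖ : ℂ) ^ 2) / (‖κ‖ : ℂ) * w t := by rw [Complex.conj_mul']
      _ = -(‖κ‖ : ℂ) * w t := by
          rw [div_mul_eq_mul_div, div_eq_iff hnorm]
          ring
  refine ⟨a, hAa, fun t ↦ ζ * u t, hu.const_mul_unit hζ, ?_⟩
  filter_upwards [hAMP w hw] with t ht hta
  obtain ⟨him, hre⟩ := ht hta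
  rw [hζu t]
  refine ⟨?_, ?_⟩
  · rw [show -(‖κ‖ : ℂ) = ((-‖κ‖ : ℝ) : ℂ) by push_cast; ring, Complex.im_ofReal_mul, him, mul_zero]
  · rw [show -(‖κ‖ : ℂ) = ((-‖κ‖ : ℝ) : ℂ) by push_cast; ring, Complex.re_ofReal_mul]
    exact mul_nonneg_of_nonpos_of_nonpos (neg_nonpos.2 (norm_nonneg κ)) hre

end Summit.RiemannHypothesis.RiemannHypothesis.Theorems.PolarPerronFrobenius

end
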